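import Summits.Ventures.CertifiedArithmetic.LowPrec.SRTreeDesign
import Mathlib.Data.Nat.Log
import HarnessLib

/-!
# Extremal summation trees for the two second-moment statistics `Λ₁` (external path length) and `Λ₂`

HONEST FRAMING: certified error envelopes and provably optimal rounding/accumulation schemes for
low-precision formats under stated cost models; every table by two implementations; no hardware
or vendor claims.

Sao, Miniskar, Valero-Lara, Teranishi and Seal [cite: SaoEtAl2026] (arXiv:2607.18758, Cor. 2.5) show
that for i.i.d. summands of mean `μ` and variance `τ²` the tree-dependent second-moment cost of a
reduction tree `T` is `τ²·Λ₁(T) + μ²·Λ₂(T)` with `Λ₁(T) = Σ_{internal v} |L(v)|` (total leaf depth,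
the external path length) and `Λ₂(T) = Σ_{internal v} |L(v)|²`; their Prop. 3.1 gives the extrema of
`Λ₁` (nearly balanced trees minimise, the sequential tree maximises) and they optimise `Λ₂` inside
blocked / fixed-stage families only.  In this development `Λ₂ = SR.sizeSq` (SRTreeDesign.lean, where
`optSq (leaves T) ≤ sizeSq T` — the balanced tree MINIMISES `Λ₂` over all binary trees — is proved)
and `Λ₁ = SR.epl` (this file).  Here we complete the extremal picture, all four corners as theorems
over every binary tree:

* `epl` (`Λ₁`), the closed recursion `optEpl n = n + optEpl ⌊n/2⌋ + optEpl ⌈n/2⌉` and its closed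
  form `optEpl n = n(L+2) − 2^(L+1)` for `2^L ≤ n ≤ 2^(L+1)` (`= n⌊log₂ n⌋ + 2(n − 2^⌊log₂ n⌋)`,
  the formula of [cite: SaoEtAl2026, Prop. 3.1]); increments
  `optEpl (n+1) − optEpl n = ⌊log₂ n⌋ + 2`;
* a GENERIC balancing lemma: any `f : ℕ → ℕ` with nondecreasing increments satisfies
  `f ⌊(i+j)/2⌋ + f ⌈(i+j)/2⌉ ≤ f i + f j` (the exchange argument behind both `optSq` and `optEpl`);
* `Λ₁` minimum: `optEpl (leaves T) ≤ epl T` for every tree, attained by the pairwise (halving) tree;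
* `Λ₁` maximum `2·epl T + 2 ≤ n(n+1)` and `Λ₂` maximum `6·sizeSq T + 6 ≤ n(n+1)(2n+1)`, both
  attained by the sequential tree (left comb; `epl_comb`, `SR.sizeSq_comb`).

So, for the certified variance bound of SRSecondMoment.lean (`treeVar ≤ (1+u²)^(h−1)(u²·Σ_v s_v² +
m q²/4)`), pairwise summation is the best and recursive summation the worst binary tree for BOTH
statistics that the i.i.d. compression of `Σ_v s_v²` produces.  Pure combinatorics; no format
enters.
-/

namespace Summit.Ventures.CertifiedArithmetic.LowPrec.SR

open Finset

/-! ### `Λ₁`: external path length -/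

/-- `Λ₁(T)`: the sum over the internal nodes of the number of leaves below the node — equivalently
the total depth of the leaves (external path length) [cite: SaoEtAl2026, Cor. 2.5, (11)]. -/
def epl {K : Type*} : STree K → ℕ
  | .leaf _ => 0
  | .node l r => (l.leaves + r.leaves) + epl l + epl r

/-- The minimal external path length by halving: `optEpl n = n + optEpl ⌊n/2⌋ + optEpl ⌈n/2⌉`. -/
def optEpl : ℕ → ℕ
  | 0 => 0
  | 1 => 0
  | n + 2 => (n + 2) + optEpl ((n + 2) / 2) + optEpl ((n + 3) / 2)
decreasing_by all_goals omega

/-- The defining equation of `optEpl` for `n ≥ 2`. -/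
theorem optEpl_eq {n : ℕ} (hn : 2 ≤ n) :
    optEpl n = n + optEpl (n / 2) + optEpl ((n + 1) / 2) := by
  obtain ⟨m, rfl⟩ : ∃ m, n = m + 2 := ⟨n - 2, by omega⟩
  rw [optEpl]

/-- Small values: `optEpl 1 … optEpl 8 = 0, 2, 5, 8, 12, 16, 20, 24`. -/
theorem optEpl_values : optEpl 1 = 0 ∧ optEpl 2 = 2 ∧ optEpl 3 = 5 ∧ optEpl 4 = 8 ∧
    optEpl 5 = 12 ∧ optEpl 6 = 16 ∧ optEpl 7 = 20 ∧ optEpl 8 = 24 := by simp [optEpl]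

/-- **Closed form**: `optEpl n + 2^(L+1) = n·(L+2)` whenever `2^L ≤ n ≤ 2^(L+1)` (both bracketing
exponents give the same value at powers of two).  With `L = ⌊log₂ n⌋` this is
`optEpl n = n⌊log₂ n⌋ + 2(n − 2^⌊log₂ n⌋)` [cite: SaoEtAl2026, Prop. 3.1]. -/
theorem optEpl_closed : ∀ (L n : ℕ), 2 ^ L ≤ n → n ≤ 2 ^ (L + 1) →
    optEpl n + 2 ^ (L + 1) = n * (L + 2) := by
  intro L
  induction L with
  | zero =>
      intro n h1 h2
      interval_cases n <;> simp [optEpl]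
  | succ L ih =>
      intro n h1 h2
      have p1 : 2 ^ (L + 1) = 2 * 2 ^ L := by ring
      have p2 : 2 ^ (L + 1 + 1) = 4 * 2 ^ L := by ring
      rw [p1] at h1
      rw [p2] at h2
      have hpos : 1 ≤ 2 ^ L := Nat.one_le_two_pow
      have hn : 2 ≤ n := by omega
      rw [optEpl_eq hn]
      have hl := ih (n / 2) (by omega) (by rw [p1]; omega)
      have hr := ih ((n + 1) / 2) (by omega) (by rw [p1]; omega)
      have e : n / 2 + (n + 1) / 2 = n := by omega
      calc n + optEpl (n / 2) + optEpl ((n + 1) / 2) + 2 ^ (L + 1 + 1)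
          = n + (optEpl (n / 2) + 2 ^ (L + 1)) + (optEpl ((n + 1) / 2) + 2 ^ (L + 1)) := by ring
        _ = n + n / 2 * (L + 2) + (n + 1) / 2 * (L + 2) := by rw [hl, hr]
        _ = n + (n / 2 + (n + 1) / 2) * (L + 2) := by ring
        _ = n * (L + 1 + 2) := by rw [e]; ring

/-- At powers of two: `optEpl (2^k) = k·2^k`. -/
theorem optEpl_two_pow (k : ℕ) : optEpl (2 ^ k) = k * 2 ^ k := by
  have h := optEpl_closed k (2 ^ k) le_rfl (Nat.pow_le_pow_right (by norm_num) (by omega))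
  rw [pow_succ] at h
  have : optEpl (2 ^ k) + 2 ^ k * 2 = k * 2 ^ k + 2 ^ k * 2 := by rw [h]; ring
  omega

/-- **Increments**: `optEpl (n+1) = optEpl n + ⌊log₂ n⌋ + 2` for `n ≥ 1`. -/
theorem optEpl_succ {n : ℕ} (hn : 1 ≤ n) : optEpl (n + 1) = optEpl n + Nat.log 2 n + 2 := by
  set L := Nat.log 2 n with hL
  have h1 : 2 ^ L ≤ n := Nat.pow_log_le_self 2 (by omega)
  have h2 : n < 2 ^ (L + 1) := Nat.lt_pow_succ_log_self (by norm_num) n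
  have ha := optEpl_closed L n h1 h2.le
  have hb := optEpl_closed L (n + 1) (by omega) (by omega)
  have : optEpl (n + 1) + 2 ^ (L + 1) = optEpl n + 2 ^ (L + 1) + (L + 2) := by
    rw [hb, ha]; ring
  omega

/-- The increments `optEpl (k+1) − optEpl k` are nondecreasing in `k`. -/
theorem optEpl_inc_mono : Monotone (fun k => (optEpl (k + 1) : ℤ) - optEpl k) := by
  refine monotone_nat_of_le_succ fun k => ?_
  rcases Nat.eq_zero_or_pos k with rfl | hk
  · simp [optEpl]
  · change (optEpl (k + 1) : ℤ) - optEpl k ≤ (optEpl (k + 1 + 1) : ℤ) - optEpl (k + 1)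
    rw [optEpl_succ (n := k + 1) (by omega), optEpl_succ hk]
    have := Nat.log_mono_right (b := 2) (show k ≤ k + 1 by omega)
    push_cast; omega

/-! ### A generic balancing lemma (the exchange argument) -/

/-- **Balancing from convexity.** If `f : ℕ → ℕ` has nondecreasing increments then the balanced
split minimises `f i + f j` over `i + j` fixed: `f ⌊(i+j)/2⌋ + f ⌈(i+j)/2⌉ ≤ f i + f j`. -/
theorem balance_of_inc_mono (f : ℕ → ℕ) (hf : Monotone (fun k => (f (k + 1) : ℤ) - f k)) :
    ∀ (d i j : ℕ), j = i + d → f ((i + j) / 2) + f ((i + j + 1) / 2) ≤ f i + f j := by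
  intro d
  induction d using Nat.strong_induction_on with
  | _ d ih =>
    intro i j hj
    rcases Nat.lt_or_ge d 2 with hd | hd
    · have e1 : (i + j) / 2 = i := by omega
      have e2 : (i + j + 1) / 2 = j := by omega
      rw [e1, e2]
    · have h := ih (d - 2) (by omega) (i + 1) (j - 1) (by omega)
      have e1 : (i + 1 + (j - 1)) / 2 = (i + j) / 2 := by omega
      have e2 : (i + 1 + (j - 1) + 1) / 2 = (i + j + 1) / 2 := by omega
      rw [e1, e2] at h
      -- exchange: `f (i+1) + f (j-1) ≤ f i + f j` from the monotone increments at `i ≤ j - 1`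
      have hx : (f (i + 1) : ℤ) - f i ≤ (f (j - 1 + 1) : ℤ) - f (j - 1) :=
        hf (show i ≤ j - 1 by omega)
      have e3 : j - 1 + 1 = j := by omega
      rw [e3] at hx
      omega

/-- The balanced split for `Λ₂`'s recursion, re-derived from the generic lemma (cf.
`SR.optSq_balance`). -/
theorem optEpl_balance (d i j : ℕ) (h : j = i + d) :
    optEpl ((i + j) / 2) + optEpl ((i + j + 1) / 2) ≤ optEpl i + optEpl j :=
  balance_of_inc_mono optEpl optEpl_inc_mono d i j h

/-! ### `Λ₁` minimum: every tree, attained by the pairwise tree -/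

/-- **`Λ₁` lower bound (every binary tree).** `optEpl (leaves T) ≤ epl T`. -/
theorem optEpl_le_epl {K : Type*} : ∀ t : STree K, optEpl t.leaves ≤ epl t
  | .leaf _ => by simp [STree.leaves, epl, optEpl]
  | .node l r => by
      have hl := optEpl_le_epl l
      have hr := optEpl_le_epl r
      have h1 := leaves_pos l
      have h2 := leaves_pos r
      simp only [STree.leaves, epl]
      rw [optEpl_eq (by omega)]
      have hb := optEpl_balance (l.leaves + r.leaves - 2 * min l.leaves r.leaves)
        (min l.leaves r.leaves) (max l.leaves r.leaves) (by omega)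
      rw [min_add_max] at hb
      have e2 : optEpl (min l.leaves r.leaves) + optEpl (max l.leaves r.leaves)
          = optEpl l.leaves + optEpl r.leaves := by
        rcases le_total l.leaves r.leaves with h | h
        · rw [min_eq_left h, max_eq_right h]
        · rw [min_eq_right h, max_eq_left h, add_comm]
      omega

/-- The pairwise tree attains it: `epl (pairwise x o n) = optEpl n` (`n ≥ 1`). -/
theorem epl_pairwise {K : Type*} (x : ℕ → K) : ∀ (n o : ℕ), 1 ≤ n →
    epl (pairwise x o n) = optEpl n := by
  intro n
  induction n using Nat.strong_induction_on with
  | _ n ih =>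
    intro o hn
    rcases Nat.lt_or_ge n 2 with h | h
    · obtain rfl : n = 1 := by omega
      simp [pairwise, epl, optEpl]
    · obtain ⟨m, rfl⟩ : ∃ m, n = m + 2 := ⟨n - 2, by omega⟩
      rw [pairwise, epl, optEpl, leaves_pairwise x _ _ (by omega), leaves_pairwise x _ _ (by omega),
        ih ((m + 2) / 2) (by omega) _ (by omega), ih ((m + 3) / 2) (by omega) _ (by omega)]
      have e : (m + 2) / 2 + (m + 3) / 2 = m + 2 := by omega
      rw [e]

/-- Hence the pairwise tree minimises `Λ₁` among all binary trees with the same number of leaves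
(the `Λ₁` half of [cite: SaoEtAl2026, Prop. 3.1]; the `Λ₂` half is `SR.sizeSq_pairwise_le`). -/
theorem epl_pairwise_le {K : Type*} (x : ℕ → K) (o : ℕ) (T : STree K) :
    epl (pairwise x o T.leaves) ≤ epl T := by
  rw [epl_pairwise x _ _ (leaves_pos T)]; exact optEpl_le_epl T

/-- `Λ₁` upper-bounds trivially by `Λ₂`: `epl T ≤ sizeSq T`. -/
theorem epl_le_sizeSq {K : Type*} : ∀ t : STree K, epl t ≤ sizeSq t
  | .leaf _ => by simp [epl, sizeSq]
  | .node l r => by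
      have hl := epl_le_sizeSq l
      have hr := epl_le_sizeSq r
      simp only [epl, sizeSq]
      nlinarith [leaves_pos l, leaves_pos r]

/-! ### Maxima: the sequential tree is the worst binary tree for both statistics -/

/-- **`Λ₁` upper bound (every binary tree)**: `2·epl T + 2 ≤ n(n+1)`, `n` = number of leaves. -/
theorem two_mul_epl_le {K : Type*} : ∀ t : STree K,
    2 * epl t + 2 ≤ t.leaves * (t.leaves + 1)
  | .leaf _ => by simp [epl, STree.leaves]
  | .node l r => by
      have hl := two_mul_epl_le l
      have hr := two_mul_epl_le r
      have h1 := leaves_pos l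
      have h2 := leaves_pos r
      simp only [epl, STree.leaves]
      nlinarith [Nat.mul_le_mul h1 h2]

/-- **`Λ₂` upper bound (every binary tree)**: `6·sizeSq T + 6 ≤ n(n+1)(2n+1)`. -/
theorem six_mul_sizeSq_le {K : Type*} : ∀ t : STree K,
    6 * sizeSq t + 6 ≤ t.leaves * (t.leaves + 1) * (2 * t.leaves + 1)
  | .leaf _ => by simp [sizeSq, STree.leaves]
  | .node l r => by
      have hl := six_mul_sizeSq_le l
      have hr := six_mul_sizeSq_le r
      have h1 := leaves_pos l
      have h2 := leaves_pos r
      simp only [sizeSq, STree.leaves]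
      obtain ⟨a, ha⟩ : ∃ a, l.leaves = a + 1 := ⟨l.leaves - 1, by omega⟩
      obtain ⟨b, hb⟩ : ∃ b, r.leaves = b + 1 := ⟨r.leaves - 1, by omega⟩
      rw [ha] at hl ⊢
      rw [hb] at hr ⊢
      nlinarith [Nat.zero_le (a * b), Nat.zero_le (a * a * b), Nat.zero_le (a * b * b)]

/-- The sequential tree attains the `Λ₁` maximum: `2·epl (comb x s n) + 2 = (n+1)(n+2)`
(`comb x s n` has `n+1` leaves). -/
theorem epl_comb {K : Type*} (x : ℕ → K) (s : K) : ∀ n : ℕ,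
    2 * epl (comb x s n) + 2 = (n + 1) * (n + 2)
  | 0 => rfl
  | n + 1 => by
      have ih := epl_comb x s n
      have hl : (comb x s n).leaves = n + 1 := by
        have := nodes_comb x s n; have := (comb x s n).nodes_add_one; omega
      simp only [comb, epl, STree.leaves, hl]
      nlinarith [ih]

/-- Summary over every binary tree `T` with `n` leaves and the pairwise / sequential trees on `n`
leaves: `Λ₁(pairwise) ≤ Λ₁(T) ≤ Λ₁(sequential)` and `Λ₂(pairwise) ≤ Λ₂(T) ≤ Λ₂(sequential)`. -/
theorem extremal_trees {K : Type*} (x : ℕ → K) (o : ℕ) (s : K) (T : STree K) :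
    epl (pairwise x o T.leaves) ≤ epl T ∧ epl T ≤ epl (comb x s (T.leaves - 1)) ∧
      sizeSq (pairwise x o T.leaves) ≤ sizeSq T ∧ sizeSq T ≤ sizeSq (comb x s (T.leaves - 1)) := by
  have hn := leaves_pos T
  refine ⟨epl_pairwise_le x o T, ?_, sizeSq_pairwise_le x o T, ?_⟩
  · have h1 := two_mul_epl_le T
    have h2 := epl_comb x s (T.leaves - 1)
    have e : T.leaves - 1 + 1 = T.leaves := by omega
    have e2 : T.leaves - 1 + 2 = T.leaves + 1 := by omega
    rw [e, e2] at h2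
    omega
  · have h1 := six_mul_sizeSq_le T
    have h2 := sizeSq_comb x s (T.leaves - 1)
    have e : T.leaves - 1 + 1 = T.leaves := by omega
    have e2 : T.leaves - 1 + 2 = T.leaves + 1 := by omega
    have e3 : 2 * (T.leaves - 1) + 3 = 2 * T.leaves + 1 := by omega
    rw [e, e2, e3] at h2
    omega

end Summit.Ventures.CertifiedArithmetic.LowPrec.SR
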